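import Mathlib

/-!
# Weighted pigeonhole over a summable family of nonnegative weights

Pure real-analysis core of the "joint quasimode pigeonhole"
(Booker–Strömbergsson–Venkatesh 2006, Lemma 3.2), used by line `Sketch` of crux
`Summit.Langlands.Langlands.Theses.QuarterDeficit1951.QuarterFingerprintDeficit`.

Given summable nonnegative weights `c i` with positive total, finitely many nonnegative
defect profiles `d v` (for `v ∈ s`) whose weighted sums satisfy
`∑' i, c i * d v i ≤ e v * ∑' i, c i`, some index `i` of positive weight satisfies
`∑ v ∈ s, d v i ≤ ∑ v ∈ s, e v`.

Proof: sum the hypotheses over `v ∈ s` and swap the finite sum with the `tsum`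
(`Summable.tsum_finsetSum`) to get `∑' i, c i * D i ≤ ∑' i, c i * E` with
`D i = ∑ v ∈ s, d v i`, `E = ∑ v ∈ s, e v`. If every positive-weight index had `E < D i`,
then termwise `c i * E ≤ c i * D i` with strict inequality at some positive-weight index
(which exists since `∑' i, c i > 0`), and `Summable.tsum_lt_tsum` gives the reverse strict
inequality, a contradiction.
-/

set_option linter.dupNamespace false

namespace Summit.Langlands.Langlands.Theorems.QuarterFingerprintDeficit

/-- **Weighted pigeonhole.** For summable nonnegative weights `c` with positive total and
finitely many nonnegative profiles `d v` (`v ∈ s`) with weighted averages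
`∑' i, c i * d v i ≤ e v * ∑' i, c i`, there is an index `i` with `0 < c i` and
`∑ v ∈ s, d v i ≤ ∑ v ∈ s, e v`. [folklore] -/
theorem stub_weightedPigeonhole {ι V : Type*} (c : ι → ℝ) (hc : Summable c) (hc0 : ∀ i, 0 ≤ c i)
    (hpos : 0 < ∑' i, c i) (s : Finset V) (d : V → ι → ℝ) (hd0 : ∀ v i, 0 ≤ d v i) (e : V → ℝ)
    (hsum : ∀ v ∈ s, Summable fun i => c i * d v i)
    (h : ∀ v ∈ s, ∑' i, c i * d v i ≤ e v * ∑' i, c i) :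
    ∃ i, 0 < c i ∧ ∑ v ∈ s, d v i ≤ ∑ v ∈ s, e v := by
  -- Nonnegativity of the profiles `d` is part of the registered interface but is not needed:
  -- summability of `c i * d v i` is given directly by `hsum`.
  have _hd0 := hd0
  by_contra hcon
  push Not at hcon
  -- `hcon : ∀ i, 0 < c i → ∑ v ∈ s, e v < ∑ v ∈ s, d v i`
  -- Summability of the summed profile.
  have hsumD : Summable fun i => c i * ∑ v ∈ s, d v i := by
    have := summable_sum (s := s) (f := fun v i => c i * d v i) hsum
    simpa only [Finset.mul_sum] using this
  have hsumE : Summable fun i => c i * ∑ v ∈ s, e v := hc.mul_right _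
  -- Summing the hypotheses over `v ∈ s`.
  have hle : ∑' i, c i * ∑ v ∈ s, d v i ≤ ∑' i, c i * ∑ v ∈ s, e v := by
    calc ∑' i, c i * ∑ v ∈ s, d v i = ∑' i, ∑ v ∈ s, c i * d v i := by
          simp only [Finset.mul_sum]
      _ = ∑ v ∈ s, ∑' i, c i * d v i := Summable.tsum_finsetSum hsum
      _ ≤ ∑ v ∈ s, e v * ∑' i, c i := Finset.sum_le_sum h
      _ = (∑' i, c i) * ∑ v ∈ s, e v := by rw [← Finset.sum_mul, mul_comm]
      _ = ∑' i, c i * ∑ v ∈ s, e v := tsum_mul_right.symm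
  -- Some index has positive weight.
  obtain ⟨i₀, hi₀⟩ : ∃ i, 0 < c i := by
    by_contra hnone
    push Not at hnone
    have hzero : ∀ i, c i = 0 := fun i => le_antisymm (hnone i) (hc0 i)
    simp [hzero] at hpos
  -- Termwise comparison, strict at `i₀`.
  have hterm : ∀ i, c i * ∑ v ∈ s, e v ≤ c i * ∑ v ∈ s, d v i := by
    intro i
    rcases (hc0 i).eq_or_lt with h0 | hposi
    · simp [← h0]
    · exact mul_le_mul_of_nonneg_left (hcon i hposi).le (hc0 i)
  have hlt : ∑' i, c i * ∑ v ∈ s, e v < ∑' i, c i * ∑ v ∈ s, d v i :=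
    hsumE.tsum_lt_tsum hterm (mul_lt_mul_of_pos_left (hcon i₀ hi₀) hi₀) hsumD
  exact absurd hle (not_le.mpr hlt)

end Summit.Langlands.Langlands.Theorems.QuarterFingerprintDeficit
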